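import Summits.QuantumFields.QCD.Theorems.QuarksAsStableActionStableActionBridgeStubBondKernelContinuous
import Summits.QuantumFields.QCD.Theorems.QuarksAsStableActionStableActionBridgeStubBondKernelStar
import Summits.QuantumFields.QCD.Theorems.QuarksAsStableActionStableActionBridgeFockLiftPosDef
import HarnessLib

/-!
# The scalarised QCD transfer kernel is a bounded, measurable, jointly continuous Hermitian kernel
# commuting with fermion parity
(stub `stub_scalarKernel_props` of line `twisted_trace_transfer` for crux
`QuarksAsStableAction.StableActionBridge`, item stmt-QuantumFields-9737, §8 E3, sub-goal C6)

Step E3 of the line realises Lüscher's transfer matrix of lattice QCD as the `L²` integral operator on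
`Y = SU(3)^{E₃} × Finset(modes)` (measure `Haar ⊗ count`) with the scalar kernel

  `k((U,s),(U',s')) = (R(U) · B(U,U') · R(U'))_{s s'}`,

where `R(U)` is a continuous Hermitian square root of the fermionic transfer operator
`T̂_F(U) = fermionSliceOp U mq` lying in the bicommutant of `T̂_F(U)`, and
`B(U,U')_{a c} = ∫ K_β(U, U'^g) Γ(G_g)_{a c} dg` is the Gauss-averaged Wilson gauge bond kernel
(`K_β = gaugeSliceKernel β`, `Γ(G_g) = fockGaugeAct g`, product Haar over the temporal links).
This file proves the five kernel facts the operator theory of E3 consumes: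

* (a) `(U,U') ↦ k((U,s),(U',s'))` is continuous for all `s, s'`: it is an entry of the product of the three
  continuous matrix-valued maps `R(U)`, `B(U,U')` (entrywise `stub_bondKernel_continuous`), `R(U')`;
* (b) `uncurry k` is strongly measurable on `Y × Y`: regroup `(X × F) × (X × F) ≃ (X × X) × (F × F)`; the
  index factor `F × F` is countable with measurable singletons, and each section in the link variables is
  continuous, hence Borel measurable (`measurable_from_prod_countable_left`; `SU(3)` is second countable, so
  the finite products carry their Borel structures);
* (c) `k` is bounded: finitely many continuous functions on the compact `X × X`;
* (d) `k(y,y') = conj k(y',y)`: `(R B(U',U) R')ᴴ = R' B(U',U)ᴴ R` with `Rᴴ = R` and `B(U',U)ᴴ = B(U,U')`,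
  the latter being `stub_bondKernel_star` entrywise;
* (e) the parity selection rule `k((U,s),(U',s')) = 0` unless `(−1)^{#s} = (−1)^{#s'}`: the fermion parity
  `Π = diag((−1)^{#s})` commutes with every second quantisation `Γ(X) = fockLift X` (its entries vanish off
  the particle-number diagonal), hence with `T̂_F = det² · Γ(M_F)` and with every `Γ(G_g)`; so it commutes
  with `R(U)` (bicommutant hypothesis) and with `B(U,U')` (entrywise under the integral), hence with
  `R B R'`; and a matrix commuting with `diag w` has vanishing `(s,s')` entry whenever `w s ≠ w s'`.

The analysis is done for an abstract compact second-countable slice space `X`, a finite index type `F`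
and abstract `R`, `B`, `w` (sub-namespace `StubScalarKernelProps`), and instantiated at the end.  Pure
theorem file (no definitions, no local notations).

References: M. Lüscher, Commun. Math. Phys. 54 (1977) 283 [Luscher1977, pp. 283–292]; J. Smit,
*Introduction to Quantum Fields on a Lattice* [Smit2023, §4.6 (4.127)–(4.137), §6.5 (6.87)–(6.91)].
-/

noncomputable section

open MeasureTheory
open scoped InnerProductSpace ComplexConjugate Matrix BigOperators
open Literature.MathematicalPhysics.QuantumFieldTheory Literature.MathematicalPhysics.QuantumLattice
open Literature.Probability.LatticeModels (TorusSite)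

namespace Summit.QuantumFields.QCD.Cruxes.StableActionBridge.TwistedTraceTransfer

namespace StubScalarKernelProps

/-! ### Matrix algebra: commuting with a diagonal matrix, number conservation of `Γ` -/

section MatrixAlgebra

variable {F : Type*} [Fintype F]

/-- The commutant of a matrix `D` is closed under products: `[D, A] = [D, B] = 0 ⟹ [D, AB] = 0`. [folklore] -/
theorem comm_mul {D A B : Matrix F F ℂ} (hA : D * A = A * D) (hB : D * B = B * D) :
    D * (A * B) = A * B * D := by
  rw [← Matrix.mul_assoc, hA, Matrix.mul_assoc, hB, Matrix.mul_assoc]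

variable [DecidableEq F]

/-- **A matrix commutes with `diag w` iff its entries vanish between distinct values of `w`**:
`diag w · M = M · diag w ↔ (w a ≠ w c → M_{ac} = 0)` (compare entries: `(w a − w c) M_{ac} = 0`). [folklore] -/
theorem diagonal_mul_eq_mul_diagonal_iff (w : F → ℂ) (M : Matrix F F ℂ) :
    Matrix.diagonal w * M = M * Matrix.diagonal w ↔ ∀ a c, w a ≠ w c → M a c = 0 := by
  constructor
  · intro h a c hw
    have h1 := congr_fun (congr_fun h a) c
    rw [Matrix.diagonal_mul, Matrix.mul_diagonal] at h1
    have h2 : (w a - w c) * M a c = 0 := by rw [sub_mul, h1, mul_comm (M a c), sub_self]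
    exact (mul_eq_zero.mp h2).resolve_left (sub_ne_zero.mpr hw)
  · intro h
    ext a c
    rw [Matrix.diagonal_mul, Matrix.mul_diagonal]
    by_cases hw : w a = w c
    · rw [hw, mul_comm]
    · rw [h a c hw, mul_zero, zero_mul]

end MatrixAlgebra

/-- **Number conservation of the second quantisation functor**: `Γ(X)_{s t} = 0` if `#s ≠ #t`. [folklore] -/
theorem fockLift_apply_of_card_ne {ι : Type*} [LinearOrder ι] (X : Matrix ι ι ℂ) {s t : Finset ι}
    (h : s.card ≠ t.card) : fockLift X s t = 0 := by
  rw [fockLift, Matrix.of_apply, dif_neg (Ne.symm h)]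

/-- **Fermion parity commutes with every `Γ(X)`**: `diag((−1)^{#s}) Γ(X) = Γ(X) diag((−1)^{#s})`
(`Γ(X)` preserves the particle number). [folklore] -/
theorem parity_comm_fockLift {ι : Type*} [LinearOrder ι] [Fintype ι] (X : Matrix ι ι ℂ) :
    Matrix.diagonal (fun s : Finset ι => (-1 : ℂ) ^ s.card) * fockLift X =
      fockLift X * Matrix.diagonal (fun s : Finset ι => (-1 : ℂ) ^ s.card) :=
  (diagonal_mul_eq_mul_diagonal_iff _ _).2 fun _ _ h =>
    fockLift_apply_of_card_ne X fun hc => h (by rw [hc])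

variable {Nf S : ℕ} [NeZero S]

/-- **Fermion parity commutes with the fermionic transfer operator** `T̂_F(U) = (det A)² · Γ(M_F(U))`.
[cite: Luscher1977, pp. 283–292] -/
theorem parity_comm_fermionSliceOp (U : GaugeConfig 3 S (Matrix.specialUnitaryGroup (Fin 3) ℂ))
    (mq : Fin Nf → ℝ) :
    Matrix.diagonal (fun s : Finset (SliceFermiIdx Nf S) => (-1 : ℂ) ^ s.card) * fermionSliceOp U mq =
      fermionSliceOp U mq * Matrix.diagonal (fun s : Finset (SliceFermiIdx Nf S) => (-1 : ℂ) ^ s.card) := by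
  rw [fermionSliceOp, Matrix.mul_smul, Matrix.smul_mul, parity_comm_fockLift]

/-- The Fock-space gauge action preserves the particle number: `Γ(G_g)_{a c} = 0` if `#a ≠ #c`.
[cite: Smit2023, §4.6 (4.125)–(4.127)] -/
theorem fockGaugeAct_apply_of_card_ne (g : TorusSite 3 S → Matrix.specialUnitaryGroup (Fin 3) ℂ)
    {a c : Finset (SliceFermiIdx Nf S)} (h : a.card ≠ c.card) :
    fockGaugeAct (Nf := Nf) g a c = 0 := by
  rw [fockGaugeAct, fockLift_apply_of_card_ne _ h]

/-! ### The kernel `k((U,s),(U',s')) = (R(U) B(U,U') R(U'))_{s s'}` over abstract data -/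

section Abstract

variable {X F : Type*} [Fintype F]
  (R : X → Matrix F F ℂ) (B : X → X → Matrix F F ℂ) (k : X × F → X × F → ℂ)

/-- (d) **Hermitian symmetry** `k(y,y') = conj k(y',y)` from `Rᴴ = R` and `B(U',U)ᴴ = B(U,U')`.
[cite: Luscher1977, pp. 283–292] -/
theorem kernel_conj_symm (hk : ∀ y y', k y y' = (R y.1 * B y.1 y'.1 * R y'.1) y.2 y'.2)
    (hRh : ∀ U, (R U)ᴴ = R U) (hBh : ∀ U U', (B U' U)ᴴ = B U U') (y y' : X × F) :
    k y y' = (starRingEnd ℂ) (k y' y) := by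
  rw [hk, hk, starRingEnd_apply, ← Matrix.conjTranspose_apply, Matrix.conjTranspose_mul,
    Matrix.conjTranspose_mul, hRh, hRh, hBh, Matrix.mul_assoc]

/-- (e) **Selection rule**: if `diag w` commutes with every `R(U)` and every `B(U,U')`, then
`k((U,s),(U',s')) = 0` whenever `w s ≠ w s'`. [cite: Luscher1977, pp. 283–292] -/
theorem kernel_selection [DecidableEq F] (hk : ∀ y y', k y y' = (R y.1 * B y.1 y'.1 * R y'.1) y.2 y'.2)
    (w : F → ℂ)
    (hRw : ∀ U, Matrix.diagonal w * R U = R U * Matrix.diagonal w)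
    (hBw : ∀ U U', Matrix.diagonal w * B U U' = B U U' * Matrix.diagonal w) (y y' : X × F)
    (h : w y.2 ≠ w y'.2) : k y y' = 0 := by
  rw [hk]
  exact (diagonal_mul_eq_mul_diagonal_iff w _).1
    (comm_mul (comm_mul (hRw y.1) (hBw y.1 y'.1)) (hRw y'.1)) y.2 y'.2 h

variable [TopologicalSpace X]

/-- (a) **Joint continuity** of `(U,U') ↦ k((U,s),(U',s'))`: an entry of the product of three continuous
matrix-valued maps. [folklore] -/
theorem continuous_kernel (hk : ∀ y y', k y y' = (R y.1 * B y.1 y'.1 * R y'.1) y.2 y'.2)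
    (hRc : Continuous R) (hBc : ∀ a c, Continuous fun q : X × X => B q.1 q.2 a c) (s s' : F) :
    Continuous fun q : X × X => k (q.1, s) (q.2, s') := by
  have hB : Continuous fun q : X × X => B q.1 q.2 := continuous_matrix fun a c => hBc a c
  have h1 : Continuous fun q : X × X => R q.1 := hRc.comp' continuous_fst
  have h2 : Continuous fun q : X × X => R q.2 := hRc.comp' continuous_snd
  have h := ((h1.matrix_mul hB).matrix_mul h2).matrix_elem s s'
  simp only [hk]
  exact h

/-- (c) **Boundedness**: finitely many continuous functions on the compact `X × X`. [folklore] -/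
theorem kernel_bounded [CompactSpace X] (hka : ∀ s s', Continuous fun q : X × X => k (q.1, s) (q.2, s')) :
    ∃ C : ℝ, ∀ y y', ‖k y y'‖ ≤ C := by
  have hsum : Continuous fun q : X × X => ∑ s, ∑ s', ‖k (q.1, s) (q.2, s')‖ :=
    continuous_finsetSum _ fun s _ => continuous_finsetSum _ fun s' _ => (hka s s').norm
  obtain ⟨C, hC⟩ := isCompact_univ.exists_bound_of_continuousOn hsum.continuousOn
  refine ⟨C, fun y y' => ?_⟩
  have h1 : ‖k y y'‖ ≤ ∑ s, ∑ s', ‖k (y.1, s) (y'.1, s')‖ :=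
    calc ‖k y y'‖ = ‖k (y.1, y.2) (y'.1, y'.2)‖ := rfl
      _ ≤ ∑ s', ‖k (y.1, y.2) (y'.1, s')‖ :=
          Finset.single_le_sum (f := fun s' => ‖k (y.1, y.2) (y'.1, s')‖) (fun _ _ => norm_nonneg _)
            (Finset.mem_univ y'.2)
      _ ≤ ∑ s, ∑ s', ‖k (y.1, s) (y'.1, s')‖ :=
          Finset.single_le_sum (f := fun s => ∑ s', ‖k (y.1, s) (y'.1, s')‖)
            (fun _ _ => Finset.sum_nonneg fun _ _ => norm_nonneg _) (Finset.mem_univ y.2)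
  exact h1.trans ((Real.le_norm_self _).trans (hC (y.1, y'.1) (Set.mem_univ _)))

/-- (b) **Strong measurability of `uncurry k` on `(X × F) × (X × F)`**: regroup to `(X × X) × (F × F)`; the
second factor is countable with measurable singletons and each section is continuous, hence measurable
(`measurable_from_prod_countable_left`). [folklore] -/
theorem kernel_stronglyMeasurable [MeasurableSpace X] [OpensMeasurableSpace X] [SecondCountableTopology X]
    [MeasurableSpace F] [MeasurableSingletonClass F]
    (hka : ∀ s s', Continuous fun q : X × X => k (q.1, s) (q.2, s')) :
    StronglyMeasurable (Function.uncurry k) := by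
  have hG : Measurable fun p : (X × X) × (F × F) => k (p.1.1, p.2.1) (p.1.2, p.2.2) :=
    measurable_from_prod_countable_left fun σ => (hka σ.1 σ.2).measurable
  have he : Measurable fun z : (X × F) × (X × F) => ((z.1.1, z.2.1), (z.1.2, z.2.2)) :=
    (measurable_fst.fst.prodMk measurable_snd.fst).prodMk (measurable_fst.snd.prodMk measurable_snd.snd)
  have hU : Function.uncurry k = (fun p : (X × X) × (F × F) => k (p.1.1, p.2.1) (p.1.2, p.2.2)) ∘
      (fun z : (X × F) × (X × F) => ((z.1.1, z.2.1), (z.1.2, z.2.2))) := by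
    funext z
    rfl
  rw [hU]
  exact (hG.comp he).stronglyMeasurable

end Abstract

end StubScalarKernelProps

open StubScalarKernelProps

/-- **Sub-goal C6 (stub `stub_scalarKernel_props` of line `twisted_trace_transfer`): the scalarised QCD
transfer kernel is a bounded, strongly measurable, jointly continuous HERMITIAN kernel commuting with
fermion parity.**  With `R` continuous, Hermitian, `R² = T̂_F`, in the bicommutant of `T̂_F`, and
`k((U,s),(U',s')) = (R(U) B(U,U') R(U'))_{s s'}`, `B(U,U')_{a c} = ∫ K_β(U,U'^g) Γ(G_g)_{a c} dg`:
(a) `(U,U') ↦ k((U,s),(U',s'))` is continuous (`stub_bondKernel_continuous`); (b) `uncurry k` is strongly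
measurable on `Y × Y`, `Y = SU(3)^{E₃} × Finset(modes)`; (c) `k` is bounded; (d) `k(y,y') = conj k(y',y)`
(`stub_bondKernel_star`, `Rᴴ = R`); (e) `k((U,s),(U',s')) = 0` unless `(−1)^{#s} = (−1)^{#s'}`
(`T̂_F = det² Γ(M_F)` and `Γ(G_g)` preserve the mode number, so they commute with `Π = diag (−1)^{#s}`;
`R` is in the bicommutant). [cite: Luscher1977, pp. 283–292] -/
theorem stub_scalarKernel_props : ∀ (Nf S : ℕ) [NeZero S] (β : ℝ) (mq : Fin Nf → ℝ), (∀ f, -1 < mq f) →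
    ∀ R : GaugeConfig 3 S (Matrix.specialUnitaryGroup (Fin 3) ℂ) → Matrix (Finset (SliceFermiIdx Nf S)) (Finset (SliceFermiIdx Nf S)) ℂ,
    Continuous R → (∀ U, (R U)ᴴ = R U ∧ R U * R U = fermionSliceOp U mq ∧
        ∀ P : Matrix (Finset (SliceFermiIdx Nf S)) (Finset (SliceFermiIdx Nf S)) ℂ,
          P * fermionSliceOp U mq = fermionSliceOp U mq * P → P * R U = R U * P) →
    ∀ k : GaugeConfig 3 S (Matrix.specialUnitaryGroup (Fin 3) ℂ) × Finset (SliceFermiIdx Nf S) → GaugeConfig 3 S (Matrix.specialUnitaryGroup (Fin 3) ℂ) × Finset (SliceFermiIdx Nf S) → ℂ,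
    (∀ y y', k y y' = (R y.1 * (Matrix.of fun a c => ∫ g : TorusSite 3 S → (Matrix.specialUnitaryGroup (Fin 3) ℂ),
          (gaugeSliceKernel β y.1 (gaugeTransform g y'.1) : ℂ) * @fockGaugeAct Nf S _ g a c
            ∂(Measure.pi fun _ => haarProbability (Matrix.specialUnitaryGroup (Fin 3) ℂ))) * R y'.1) y.2 y'.2) →
    (∀ s s' : Finset (SliceFermiIdx Nf S), Continuous fun q : GaugeConfig 3 S (Matrix.specialUnitaryGroup (Fin 3) ℂ) × GaugeConfig 3 S (Matrix.specialUnitaryGroup (Fin 3) ℂ) => k (q.1, s) (q.2, s')) ∧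
    StronglyMeasurable (Function.uncurry k) ∧ (∃ C : ℝ, ∀ y y', ‖k y y'‖ ≤ C) ∧
    (∀ y y', k y y' = (starRingEnd ℂ) (k y' y)) ∧
    (∀ y y', (-1 : ℂ) ^ y.2.card ≠ (-1 : ℂ) ^ y'.2.card → k y y' = 0) := by
  intro Nf S _ β mq _hmq R hRc hR k hk
  haveI : SecondCountableTopology (Matrix (Fin 3) (Fin 3) ℂ) :=
    inferInstanceAs (SecondCountableTopology (Fin 3 → Fin 3 → ℂ))
  haveI : SecondCountableTopology (Matrix.specialUnitaryGroup (Fin 3) ℂ) :=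
    Topology.IsEmbedding.subtypeVal.secondCountableTopology
  -- abstract the Gauss-averaged bond kernel `B(U,U')`
  obtain ⟨B, hB⟩ : ∃ B : GaugeConfig 3 S (Matrix.specialUnitaryGroup (Fin 3) ℂ) →
      GaugeConfig 3 S (Matrix.specialUnitaryGroup (Fin 3) ℂ) →
        Matrix (Finset (SliceFermiIdx Nf S)) (Finset (SliceFermiIdx Nf S)) ℂ,
      ∀ U U', B U U' = Matrix.of fun a c => ∫ g : TorusSite 3 S → (Matrix.specialUnitaryGroup (Fin 3) ℂ),
          (gaugeSliceKernel β U (gaugeTransform g U') : ℂ) * @fockGaugeAct Nf S _ g a c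
            ∂(Measure.pi fun _ => haarProbability (Matrix.specialUnitaryGroup (Fin 3) ℂ)) :=
    ⟨_, fun _ _ => rfl⟩
  have hk' : ∀ y y', k y y' = (R y.1 * B y.1 y'.1 * R y'.1) y.2 y'.2 := fun y y' => by rw [hk, hB]
  -- the inputs of the abstract lemmas
  have hBc : ∀ a c, Continuous fun q : GaugeConfig 3 S (Matrix.specialUnitaryGroup (Fin 3) ℂ) ×
      GaugeConfig 3 S (Matrix.specialUnitaryGroup (Fin 3) ℂ) => B q.1 q.2 a c := fun a c => by
    simp only [hB, Matrix.of_apply]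
    exact stub_bondKernel_continuous Nf S β a c
  have hBh : ∀ U U', (B U' U)ᴴ = B U U' := fun U U' => by
    ext a c
    rw [Matrix.conjTranspose_apply, hB, hB, Matrix.of_apply, Matrix.of_apply,
      stub_bondKernel_star Nf S β U U' a c, Complex.star_def, Complex.conj_conj]
  have hBw : ∀ U U', Matrix.diagonal (fun s : Finset (SliceFermiIdx Nf S) => (-1 : ℂ) ^ s.card) * B U U' =
      B U U' * Matrix.diagonal (fun s : Finset (SliceFermiIdx Nf S) => (-1 : ℂ) ^ s.card) := fun U U' => by
    refine (diagonal_mul_eq_mul_diagonal_iff _ _).2 fun a c hac => ?_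
    have hne : a.card ≠ c.card := fun h => hac (by rw [h])
    rw [hB, Matrix.of_apply]
    simp only [fockGaugeAct_apply_of_card_ne _ hne, mul_zero, integral_zero]
  have hRw : ∀ U, Matrix.diagonal (fun s : Finset (SliceFermiIdx Nf S) => (-1 : ℂ) ^ s.card) * R U =
      R U * Matrix.diagonal (fun s : Finset (SliceFermiIdx Nf S) => (-1 : ℂ) ^ s.card) := fun U =>
    (hR U).2.2 _ (parity_comm_fermionSliceOp U mq)
  have hka := continuous_kernel R B k hk' hRc hBc
  exact ⟨hka, kernel_stronglyMeasurable k hka, kernel_bounded k hka,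
    kernel_conj_symm R B k hk' (fun U => (hR U).1) hBh,
    fun y y' h => kernel_selection R B k hk' _ hRw hBw y y' h⟩

end Summit.QuantumFields.QCD.Cruxes.StableActionBridge.TwistedTraceTransfer

end
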